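import Summits.NavierStokesRegularity.FluidComputer.SwirlRateBarrier
import Summits.NavierStokesRegularity.FluidComputer.ClayBlowupLocalMeridionalTypeI
import HarnessLib

/-!
# THE SWIRL OF AN AXISYMMETRIC CLAY BLOW-UP NEVER BLOWS UP FASTER THAN ITS MERIDIONAL FLOW
# (with the Clay force; every rate, every axis point)

Cell `ns-blowup`, seat `ns-blowup-ecbridge-2` (g13; the E–C endpoint theory seat). LABEL: E–C typing
(KERNEL — no named fact, no new definition, no conjecture hypothesis). WHAT THIS IS NOT: not
Navier–Stokes evidence — necessary conditions on the TYPE `ClayBlowup ν`; no inhabitant is claimed.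
Companion memo: `run/shared/lean/pub/ns-blowup/ecbridge2/ECBRIDGE-2-MEMO-12.md` (§5).

## Content

The rate-free swirl barrier `exists_swirl_le_rateBarrier` (`SwirlRateBarrier.lean`: comparison for
`Γ = r u_θ` on the shrinking balls `|x − c| ≤ ℓ(t)` around axis points, for ANY non-increasing
differentiable scale `ℓ`), centred at the foot of each point on the axis, gives on the type:

* **`ClayBlowup.exists_swirlVelocity_le_of_meridionalRate`** (`ν > 0`; axisymmetric datum and Clay
  force; `x₁` on the axis; `ℓ` positive, differentiable, non-increasing on `[t₀, T)`, `ℓ(t₀) ≤ R/2`):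
  `|ū(t, x)| ≤ C₀/ℓ(t)` on `[t₀, T) × B(x₁, R)` ⟹ `|u_θ(t, x)| ≤ C'/ℓ(t)` on `[t₀, T) × B(x₁, R/2)`
  — THE SWIRL VELOCITY IS SLAVED TO THE MERIDIONAL RATE, WHATEVER THE RATE (Type I, Type II, …);
* `ClayBlowup.exists_swirlVelocity_le_of_meridional_bounded` — the scale-free special case
  `ℓ ≡ const`: a bound `|ū| ≤ M` on `(t₀, T) × B(x₁, R)` forces `|u_θ| ≤ M'` on
  `(t₀, T) × B(x₁, R/2)`, uniformly up to `T`;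
* **`ClayBlowup.meridional_unbounded_near_singularPoint`** — at a point which is not backward
  bounded, the MERIDIONAL velocity `ū` is unbounded in `(t₀, T) × B(x₁, R)` for every `t₀ < T`,
  `R > 0`: the blow-up of an axisymmetric Clay blow-up is always carried (at least) by the meridional
  components — the swirl cannot blow up alone, nor faster.

References: Koch–Nadirashvili–Seregin–Šverák, Acta Math. 203 (2009), §1 (1.8)–(1.9)
[cite: KochNadirashviliSereginSverak2009, §1 (1.8)–(1.9)]; Seregin–Šverák, Comm. PDE 34 (2009), §1,
p. 4 [cite: SereginSverak2009, §1 p. 4]; C. L. Fefferman, (C) [cite: FeffermanClay2006, (C)].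
-/

noncomputable section

namespace Summit.NavierStokesRegularity.FluidComputer

open Set MeasureTheory Filter Topology Function Metric
open scoped NNReal ContDiff RealInnerProductSpace
open Literature.Analysis Literature.Analysis.FluidPDE
open Summit.NavierStokesRegularity.NavierStokesRegularity

namespace ClayBlowup

variable {ν : ℝ} (X : ClayBlowup ν)

/-- **THE SWIRL VELOCITY OF AN AXISYMMETRIC CLAY BLOW-UP IS SLAVED TO THE MERIDIONAL RATE — EVERY
RATE** (`ν > 0`; axisymmetric datum and Clay force; `x₁` on the axis; no named fact). Let `ℓ` be
positive, differentiable and non-increasing on `[t₀, T)` (`0 ≤ t₀ < T`) with `ℓ(t₀) ≤ R/2`. If the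
meridional velocity obeys `|ū(t, x)| ≤ C₀/ℓ(t)` for `t ∈ [t₀, T)`, `x ∈ B(x₁, R)`, then for some `C'`:
`|u_θ(t, x)| ≤ C'/ℓ(t)` for `t ∈ [t₀, T)`, `x ∈ B(x₁, R/2)`. The barrier of
`exists_swirl_le_rateBarrier` centred at the foot `(0,0,x₂)` of `x` (`|x − foot| = r`,
`B(foot, R/2) ⊆ B(x₁, R)`) gives `|Γ| ≤ K r/ℓ(t)` for `r ≤ ℓ(t)`; for `r > ℓ(t)` the swirl bound
`|Γ| ≤ C_Γ` (`swirl_bounded`) gives `|u_θ| ≤ C_Γ/ℓ(t)`. [cite: SereginSverak2009, §1 p. 4] -/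
theorem exists_swirlVelocity_le_of_meridionalRate (hν : 0 < ν) (h0A : IsAxisymmetric (X.u 0))
    (hfA : ∀ t ∈ Ico 0 X.T, IsAxisymmetric (X.f t)) {x₁ : EuclideanSpace ℝ (Fin 3)}
    (hx₁ : cylRadius x₁ = 0) {R : ℝ} (hR : 0 < R) {t₀ : ℝ} (ht₀ : t₀ ∈ Ico 0 X.T)
    {ℓ dℓ : ℝ → ℝ} (hℓd : ∀ t ∈ Ico t₀ X.T, HasDerivAt ℓ (dℓ t) t)
    (hdℓ : ∀ t ∈ Ico t₀ X.T, dℓ t ≤ 0) (hℓpos : ∀ t ∈ Ico t₀ X.T, 0 < ℓ t)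
    (hanti : AntitoneOn ℓ (Ico t₀ X.T)) (hℓR : ℓ t₀ ≤ R / 2) {C₀ : ℝ} (hC₀ : 0 ≤ C₀)
    (hmer : ∀ t ∈ Ico t₀ X.T, ∀ x ∈ ball x₁ R, ‖poloidalPart (X.u t) x‖ ≤ C₀ / ℓ t) :
    ∃ C' : ℝ, ∀ t ∈ Ico t₀ X.T, ∀ x ∈ ball x₁ (R / 2),
      |swirlVelocity (X.u t) x| ≤ C' / ℓ t := by
  have hT := X.T_pos
  have hax : ∀ t ∈ Ico 0 X.T, IsAxisymmetric (X.u t) := X.isAxisymmetric hν h0A hfA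
  obtain ⟨CΓ, hCΓ0, hΓ⟩ := X.swirl_bounded hν h0A hfA
  obtain ⟨B, hB⟩ := X.exists_norm_le hν ht₀.2
  have hB0 : 0 ≤ B := (norm_nonneg _).trans (hB 0 ⟨le_rfl, ht₀.1⟩ 0)
  obtain ⟨F, hF0, hF⟩ := X.exists_norm_force_le
  obtain ⟨K, hK0, hK⟩ := exists_swirl_le_rateBarrier hν hC₀ hCΓ0 hB0 hF0 (half_pos hR)
  set a : ℝ := (C₀ + 1) / ν with ha
  have ha0 : 0 < a := by rw [ha]; positivity
  have hℓt₀ : 0 < ℓ t₀ := hℓpos t₀ ⟨le_rfl, ht₀.2⟩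
  refine ⟨K + CΓ + B * (R / 2), fun t ht x hx => ?_⟩
  have hℓt : 0 < ℓ t := hℓpos t ht
  have hℓle : ℓ t ≤ R / 2 := (hanti ⟨le_rfl, ht₀.2⟩ ht ht.1).trans hℓR
  have hxR : x ∈ ball x₁ R := ball_subset_ball (by linarith) hx
  have htI : t ∈ Ico 0 X.T := ⟨ht₀.1.trans ht.1, ht.2⟩
  -- the case `t = t₀`: the slab bound
  rcases eq_or_lt_of_le ht.1 with heq | ht₀t
  · subst heq
    have h1 : |swirlVelocity (X.u t₀) x| ≤ B :=
      (SereginSverak2009.abs_swirlVelocity_le_norm (X.u t₀) x).trans (hB t₀ ⟨ht₀.1, le_rfl⟩ x)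
    rw [le_div_iff₀ hℓt]
    nlinarith [mul_nonneg hK0 hℓt.le, mul_nonneg hCΓ0 hℓt.le, abs_nonneg (swirlVelocity (X.u t₀) x)]
  -- the case `t₀ < t`: the barrier on `[t₀, t]` centred at the foot of `x`
  by_cases hr : cylRadius x = 0
  · have h1 : swirlVelocity (X.u t) x = 0 := by simp [swirlVelocity, eTheta, hr]
    rw [h1, abs_zero]; positivity
  have hr0 : 0 < cylRadius x := lt_of_le_of_ne (cylRadius_nonneg x) (Ne.symm hr)
  set r : ℝ := cylRadius x with hrdef
  have hsv : |swirlVelocity (X.u t) x| = |swirl (X.u t) x| / r := by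
    rw [swirl_eq_cylRadius_mul_swirlVelocity (X.u t) hr, abs_mul, abs_of_pos hr0]
    field_simp
  rw [hsv, div_le_div_iff₀ hr0 hℓt]
  by_cases hrl : r ≤ ℓ t
  · -- inside the moving ball: the barrier
    set c : EuclideanSpace ℝ (Fin 3) := EuclideanSpace.single (2 : Fin 3) (x 2) with hcdef
    have hc : cylRadius c = 0 := cylRadius_axisFoot x
    have hxc : ‖x - c‖ = cylRadius x := norm_sub_axisFoot x
    have hcx₁ : ‖c - x₁‖ < R / 2 :=
      lt_of_le_of_lt (norm_axisFoot_sub_le hx₁ x) (mem_ball_iff_norm.1 hx)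
    have hball : ball c (R / 2) ⊆ ball x₁ R := fun y hy => by
      rw [mem_ball_iff_norm] at hy ⊢
      calc ‖y - x₁‖ = ‖(y - c) + (c - x₁)‖ := by rw [sub_add_sub_cancel]
        _ ≤ ‖y - c‖ + ‖c - x₁‖ := norm_add_le _ _
        _ < R := by linarith
    have hsubI : Icc t₀ t ⊆ Ico t₀ X.T := fun s hs => ⟨hs.1, hs.2.trans_lt ht.2⟩
    have hsub0 : Icc t₀ t ⊆ Ico 0 X.T := fun s hs => ⟨ht₀.1.trans hs.1, hs.2.trans_lt ht.2⟩
    have hcl : IsClassicalNSSolutionOn (Icc t₀ t) ν X.f X.u X.p :=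
      X.classical.mono hsub0 (uniqueDiffOn_Icc ht₀t)
    have hdrift : ∀ s ∈ Icc t₀ t, ∀ y ∈ ball c (R / 2),
        -(C₀ * ‖y - c‖ / ℓ s) ≤ ⟪y - c, X.u s y⟫ := by
      intro s hs y hy
      rw [inner_sub_axisPoint_eq_inner_poloidalPart hc]
      have h1 : |⟪y - c, poloidalPart (X.u s) y⟫| ≤ C₀ * ‖y - c‖ / ℓ s :=
        calc |⟪y - c, poloidalPart (X.u s) y⟫| ≤ ‖y - c‖ * ‖poloidalPart (X.u s) y‖ :=
              abs_real_inner_le_norm _ _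
          _ ≤ ‖y - c‖ * (C₀ / ℓ s) :=
              mul_le_mul_of_nonneg_left (hmer s (hsubI hs) y (hball hy)) (norm_nonneg _)
          _ = C₀ * ‖y - c‖ / ℓ s := by ring
      exact (abs_le.1 h1).1
    have hb := hK t₀ t ℓ dℓ X.u X.f X.p c ht₀t hcl (fun s hs => hax s (hsub0 hs))
      (fun s hs => hfA s (hsub0 hs)) hc (fun s hs => hℓd s (hsubI hs))
      (fun s hs => hdℓ s (hsubI hs)) (fun s hs => hℓpos s (hsubI hs))
      (fun s hs => (hanti ⟨le_rfl, ht₀.2⟩ (hsubI hs) hs.1).trans hℓR)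
      (hanti.mono hsubI) hdrift (fun s hs y _ => hΓ s (hsub0 hs) y)
      (fun y _ => hB t₀ ⟨ht₀.1, le_rfl⟩ y) (fun s hs y _ => hF s (ht₀.1.trans hs.1) y)
      t ⟨ht₀t.le, le_rfl⟩ x (by rw [hxc]; exact hrl)
    rw [hxc, ← hrdef] at hb
    have hΨ : (1 - Real.exp (-(a * (r / ℓ t)))) / a ≤ r / ℓ t := swirlProfile_le_self ha0 _
    have h1 : |swirl (X.u t) x| ≤ K * (r / ℓ t) := hb.trans (mul_le_mul_of_nonneg_left hΨ hK0)
    have h4 : K * (r / ℓ t) * ℓ t = K * r := by field_simp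
    calc |swirl (X.u t) x| * ℓ t ≤ K * (r / ℓ t) * ℓ t := mul_le_mul_of_nonneg_right h1 hℓt.le
      _ = K * r := h4
      _ ≤ (K + CΓ + B * (R / 2)) * r := by nlinarith [mul_nonneg hB0 hR.le]
  · -- outside the moving ball: the swirl bound
    push Not at hrl
    have h1 : |swirl (X.u t) x| ≤ CΓ := hΓ t htI x
    calc |swirl (X.u t) x| * ℓ t ≤ CΓ * r := by
          have := mul_le_mul h1 hrl.le hℓt.le hCΓ0
          linarith
      _ ≤ (K + CΓ + B * (R / 2)) * r := by nlinarith [mul_nonneg hB0 hR.le]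

/-- **BOUNDED MERIDIONAL VELOCITY NEAR AN AXIS POINT FORCES BOUNDED SWIRL VELOCITY THERE, UNIFORMLY
UP TO `T`** (`ν > 0`; axisymmetric datum and Clay force; the scale-free case `ℓ ≡ R/2` of
`exists_swirlVelocity_le_of_meridionalRate`): `|ū| ≤ M` on `[t₀, T) × B(x₁, R)` ⟹
`|u_θ| ≤ M'` on `[t₀, T) × B(x₁, R/2)`. [cite: SereginSverak2009, §1 p. 4] -/
theorem exists_swirlVelocity_le_of_meridional_bounded (hν : 0 < ν) (h0A : IsAxisymmetric (X.u 0))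
    (hfA : ∀ t ∈ Ico 0 X.T, IsAxisymmetric (X.f t)) {x₁ : EuclideanSpace ℝ (Fin 3)}
    (hx₁ : cylRadius x₁ = 0) {R : ℝ} (hR : 0 < R) {t₀ : ℝ} (ht₀ : t₀ ∈ Ico 0 X.T) {M : ℝ}
    (hM : 0 ≤ M) (hmer : ∀ t ∈ Ico t₀ X.T, ∀ x ∈ ball x₁ R, ‖poloidalPart (X.u t) x‖ ≤ M) :
    ∃ M' : ℝ, ∀ t ∈ Ico t₀ X.T, ∀ x ∈ ball x₁ (R / 2), |swirlVelocity (X.u t) x| ≤ M' := by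
  obtain ⟨C', hC'⟩ := X.exists_swirlVelocity_le_of_meridionalRate hν h0A hfA hx₁ hR ht₀
    (ℓ := fun _ => R / 2) (dℓ := fun _ => 0) (fun t _ => hasDerivAt_const t (R / 2))
    (fun _ _ => le_rfl) (fun _ _ => half_pos hR) (fun _ _ _ _ _ => le_rfl) le_rfl
    (C₀ := M * (R / 2)) (by positivity)
    (fun t ht x hx => by
      rw [mul_div_assoc, div_self (half_pos hR).ne', mul_one]; exact hmer t ht x hx)
  exact ⟨C' / (R / 2), fun t ht x hx => hC' t ht x hx⟩

/-- **THE BLOW-UP OF AN AXISYMMETRIC CLAY BLOW-UP IS CARRIED BY THE MERIDIONAL FIELD** (`ν > 0`;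
axisymmetric datum and Clay force; no named fact): at a point `x₁` which is not backward bounded at
`T`, for every `t₀ ∈ [0, T)`, `R > 0` and `M`, the meridional velocity exceeds `M` somewhere in
`[t₀, T) × B(x₁, R)` — the swirl velocity cannot blow up alone (a bounded `ū` is in particular
meridionally Type I, which `not_localMeridionalTypeI_of_isAxisymmetric_forced` excludes at `x₁`; and by
`exists_swirlVelocity_le_of_meridional_bounded` the swirl would then be bounded too).
[cite: SereginSverak2009, §1 p. 4] [cite: FeffermanClay2006, (C)] -/
theorem meridional_unbounded_near_singularPoint (hν : 0 < ν) (h0A : IsAxisymmetric (X.u 0))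
    (hfA : ∀ t ∈ Ico 0 X.T, IsAxisymmetric (X.f t)) {x₁ : EuclideanSpace ℝ (Fin 3)}
    (hx₁ : ¬ IsBackwardBoundedAt X.u X.T x₁) {R : ℝ} (hR : 0 < R) {t₀ : ℝ} (ht₀ : t₀ ∈ Ico 0 X.T)
    (M : ℝ) : ∃ t ∈ Ico t₀ X.T, ∃ x ∈ ball x₁ R, M < ‖poloidalPart (X.u t) x‖ := by
  by_contra hcon
  push Not at hcon
  have hM0 : 0 ≤ M := (norm_nonneg _).trans (hcon t₀ ⟨le_rfl, ht₀.2⟩ x₁ (mem_ball_self hR))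
  -- a bounded `ū` obeys in particular the meridional Type-I bound with constant `M √T`,
  -- excluded at the singular point `x₁` (`not_localMeridionalTypeI_of_isAxisymmetric_forced`)
  have hT := X.T_pos
  refine X.not_localMeridionalTypeI_of_isAxisymmetric_forced hν h0A hfA hx₁ (half_pos hR)
    (M * Real.sqrt X.T) ?_
  filter_upwards [Ioo_mem_nhdsLT ht₀.2] with t ht x hx
  have hgap : 0 < X.T - t := by linarith [ht.2]
  have hsq : Real.sqrt (X.T - t) ≤ Real.sqrt X.T :=
    Real.sqrt_le_sqrt (by linarith [ht₀.1, ht.1])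
  have hsq0 : 0 < Real.sqrt (X.T - t) := Real.sqrt_pos.2 hgap
  have h1 : ‖poloidalPart (X.u t) x‖ ≤ M := hcon t ⟨ht.1.le, ht.2⟩ x (ball_subset_ball (by linarith) hx)
  rw [le_div_iff₀ hsq0]
  calc ‖poloidalPart (X.u t) x‖ * Real.sqrt (X.T - t) ≤ M * Real.sqrt (X.T - t) :=
        mul_le_mul_of_nonneg_right h1 hsq0.le
    _ ≤ M * Real.sqrt X.T := mul_le_mul_of_nonneg_left hsq hM0

end ClayBlowup

/-- **DesignedBlowup twin: the swirl velocity is slaved to the meridional rate.**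
[cite: SereginSverak2009, §1 p. 4] -/
theorem DesignedBlowup.meridional_unbounded_near_singularPoint {ν : ℝ} (D : DesignedBlowup ν)
    (hν : 0 < ν) (h0A : IsAxisymmetric (D.u 0)) (hfA : ∀ t ∈ Ico 0 D.T, IsAxisymmetric (D.f t))
    {x₁ : EuclideanSpace ℝ (Fin 3)} (hx₁ : ¬ IsBackwardBoundedAt D.u D.T x₁) {R : ℝ} (hR : 0 < R)
    {t₀ : ℝ} (ht₀ : t₀ ∈ Ico 0 D.T) (M : ℝ) :
    ∃ t ∈ Ico t₀ D.T, ∃ x ∈ ball x₁ R, M < ‖poloidalPart (D.u t) x‖ :=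
  D.toClayBlowup.meridional_unbounded_near_singularPoint hν h0A hfA hx₁ hR ht₀ M

end Summit.NavierStokesRegularity.FluidComputer

end

/-! ## Appendix (g13, append-only): the scale normalisation `ℓ(t₀) ≤ R/2` removed -/

noncomputable section

namespace Summit.NavierStokesRegularity.FluidComputer

open Set MeasureTheory Filter Topology Function Metric
open scoped NNReal ContDiff RealInnerProductSpace
open Literature.Analysis Literature.Analysis.FluidPDE
open Summit.NavierStokesRegularity.NavierStokesRegularity

namespace ClayBlowup

variable {ν : ℝ} (X : ClayBlowup ν)

/-- **The swirl velocity is slaved to the meridional rate — without the normalisation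
`ℓ(t₀) ≤ R/2`** (`ν > 0`; axisymmetric datum and Clay force; `x₁` on the axis): for ANY positive,
differentiable, non-increasing scale `ℓ` on `[t₀, T)`, `|ū(t, x)| ≤ C₀/ℓ(t)` on `[t₀, T) × B(x₁, R)`
implies `|u_θ(t, x)| ≤ C'/ℓ(t)` on `[t₀, T) × B(x₁, R/2)` (rescale `ℓ ↦ λℓ`, `C₀ ↦ λC₀` with
`λ = min 1 (R/(2ℓ(t₀)))` in `exists_swirlVelocity_le_of_meridionalRate`; the hypothesis only sees
`C₀/ℓ`). [cite: SereginSverak2009, §1 p. 4] -/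
theorem exists_swirlVelocity_le_of_meridionalRate' (hν : 0 < ν) (h0A : IsAxisymmetric (X.u 0))
    (hfA : ∀ t ∈ Ico 0 X.T, IsAxisymmetric (X.f t)) {x₁ : EuclideanSpace ℝ (Fin 3)}
    (hx₁ : cylRadius x₁ = 0) {R : ℝ} (hR : 0 < R) {t₀ : ℝ} (ht₀ : t₀ ∈ Ico 0 X.T)
    {ℓ dℓ : ℝ → ℝ} (hℓd : ∀ t ∈ Ico t₀ X.T, HasDerivAt ℓ (dℓ t) t)
    (hdℓ : ∀ t ∈ Ico t₀ X.T, dℓ t ≤ 0) (hℓpos : ∀ t ∈ Ico t₀ X.T, 0 < ℓ t)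
    (hanti : AntitoneOn ℓ (Ico t₀ X.T)) {C₀ : ℝ} (hC₀ : 0 ≤ C₀)
    (hmer : ∀ t ∈ Ico t₀ X.T, ∀ x ∈ ball x₁ R, ‖poloidalPart (X.u t) x‖ ≤ C₀ / ℓ t) :
    ∃ C' : ℝ, ∀ t ∈ Ico t₀ X.T, ∀ x ∈ ball x₁ (R / 2),
      |swirlVelocity (X.u t) x| ≤ C' / ℓ t := by
  have hℓt₀ : 0 < ℓ t₀ := hℓpos t₀ ⟨le_rfl, ht₀.2⟩
  set lam : ℝ := min 1 (R / 2 / ℓ t₀) with hlam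
  have hlam0 : 0 < lam := lt_min one_pos (by positivity)
  have hlam1 : lam ≤ 1 := min_le_left _ _
  obtain ⟨C', hC'⟩ := X.exists_swirlVelocity_le_of_meridionalRate hν h0A hfA hx₁ hR ht₀
    (ℓ := fun t => lam * ℓ t) (dℓ := fun t => lam * dℓ t)
    (fun t ht => (hℓd t ht).const_mul lam)
    (fun t ht => mul_nonpos_of_nonneg_of_nonpos hlam0.le (hdℓ t ht))
    (fun t ht => mul_pos hlam0 (hℓpos t ht))
    (fun s hs t ht hst => mul_le_mul_of_nonneg_left (hanti hs ht hst) hlam0.le)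
    (by
      have h1 : lam * ℓ t₀ ≤ R / 2 / ℓ t₀ * ℓ t₀ :=
        mul_le_mul_of_nonneg_right (min_le_right _ _) hℓt₀.le
      rwa [div_mul_cancel₀ _ hℓt₀.ne'] at h1)
    (C₀ := lam * C₀) (by positivity)
    (fun t ht x hx => by
      rw [mul_div_mul_left _ _ hlam0.ne']; exact hmer t ht x hx)
  refine ⟨C' / lam, fun t ht x hx => ?_⟩
  have h := hC' t ht x hx
  rwa [div_mul_eq_div_div_swap, div_div, mul_comm, ← div_div] at h

end ClayBlowup

end Summit.NavierStokesRegularity.FluidComputer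

end
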